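import Summits.QuantumFields.BalabanUV.T4Continuum.Support.NE9CurveRemainderCoupling
import Summits.QuantumFields.BalabanUV.T4Continuum.Support.NE9RemainderPieceLinear

/-!
# NE9CurveRemainderLinear — `curPiece Γ − curPiece Γ′` IS the (1.23)-functional of the curve-remainder difference, hence the
# CURVE species' per-piece COUPLING RESPONSE (leaf A3) in CLOSED FORM (cell `pub-balaban`, T4-DAG §2 node U3 ∕ §6 NE9; NE9
# formalisation swarm, unit `b2b-balaban-t4-ne9-formalise-leaf-05` gen 5; crew row (w20) «A3-REM twin on `CurData`» of the row
# OWNER t4-ne9-p1 g25 (CLAIMS.log l.9603), SPECIES HALF, CLAIM l.10038 — GENERIC part; the species part is the sibling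
# `NE9CurveSpeciesCoupling`; the engine is leaf-06-g7's `NE9CurveRemainderCoupling` p213961, whose §2 left exactly this
# identification «instantiation-side (linearity of INTEGRABLE contour integrals)»; the ray predecessor is leaf-03-g4's
# `NE9RemainderPieceLinear` p212900)

HONEST FRAMING (T4-DAG PAGE 1).  Rung (B)+1 of the FINITE-VOLUME T⁴ programme — existence AND uniqueness of the ε → 0 limit
of gauge-invariant observables on a fixed torus; NOT infinite volume, NOT a mass gap, NOT the Clay problem.  NE9
(`T4OutputRate.NE9` ∧ `FadingMemory`) is a cell NEW ESTIMATE, NOT PRINTED, and is NOT discharged here («NE9 ⇐ the named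
binders»); spine 0∕9; 0∕18 skeleton leaves instantiated on Bałaban's objects (O-NE9-1).  HONEST DEPENDENCY (cell line,
verbatim): continuum YM on T⁴ ⇐ BetaPertH ∧ nine spine estimates (0/9 proved); BetaPertH ⇐ (D1) ∧ (D4) ∧ CAP+tail; G-an2-4
gates asym, D1 and NE2/3/4.  Pure calculus on an abstract complex normed configuration space `E` and the row owner's
FORM-level objects `NE9Lemma1CurveRemainder.curRem` ∕ `curPiece` (t4-ne9-p1 g25, LOCATED CORRECTION O-ne9p1g25-1: [I]
(3.34)∕(3.54) expand the old term along the analytic CURVE σ′ ↦ U_j(□₀, exp i(B + σ′B))|_X of Lemma 4 (3.53) — a ray only for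
abelian G); [I] = [Balaban1987RG1] (CMP **109**), [II] = [Balaban1988RG2Cluster] (CMP **116**) quoted for TYPES only (ABSOLUTE
RULE: nothing printed in the audited series is asserted).  No `def`, no Prop-valued definition; `FlowStep.BetaPertH`, (B), (B^μ)
do not occur.

WHERE THIS SITS.  Leaf A3 (`hTcup`) on a class-relative piece form is ONE displayed per-piece COUPLING-RESPONSE bound `hresp`
(`NE9CPieceCouplingModulus.channelCouplingModulus_cpiece`, leaf-09-g4).  For the curve species the coupling enters through the
SLICE CURVE (the Lemma-4 curve through the contour point moves with the shift amplitude, [II] (1.21)); leaf-06-g7's engine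
proved `norm_curPieceDiff_le` for the (1.23)-functional of the remainder DIFFERENCE of two δ-close slice-curve families and LEFT
OPEN its identification with `curPiece(…Γ…) − curPiece(…Γ′…)`.  THIS FILE supplies it under the natural regularity, JOINT
CONTINUITY OF THE SLICE-CURVE FAMILY ON (contours) × {|τ| = 1} (a displayed binder of the species; TYPE: [II] p. 7 continues the
(1.23)-integrands analytically in the contour variables — *"we represent all derivatives by the Cauchy formula"*; asserted here
for nothing of Bałaban's):
* §1 `curRem_eq_sub_sum` (closed form along a curve: `H(γ 1) − Σ_{m<n}(2πi)⁻¹∮_{|τ|=1} τ^{−(m+1)} H(γ τ) dτ`, via leaf-03-g4's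
  `tail_eq_circleIntegral`) and **`continuousOn_curRem_comp`**: for a slice-curve family `Γ : P → ℂ → E` on a parameter SET
  `S` (per-p analytic on `|τ| < ϱ` into the analyticity ball, ϱ > 1) JOINTLY continuous on `S ×ˢ {|τ| = 1}`,
  `p ↦ curRem H n (Γ p)` is continuous on `S` (parametric Cauchy integrals; the SET form the contour binders need; no sup bound
  on H) — the curve twin of `NE9RemainderPieceLinear.continuousOn_dirRem`.
* §2 **`curPiece_sub_curPiece`** — THE IDENTITY (`NE9CauchyOpLinear.pieceOp_sub` with the integrands
  `(t, s, σ) ↦ curRem H n (Γ t s σ)` continuous by §1) and **`norm_curPiece_sub_curPiece_le`**: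
  `‖curPiece e^{κ₁} r l H n Γ s σ − curPiece e^{κ₁} r l H n Γ′ s σ‖ ≤ (1∕r)·(2ⁿ·(2M∕(R−R′)·δ)·ϱ⁻¹ⁿ)·exp(−(κ₁−1)·#l)` for `H`
  analytic with sup `M` on `‖z‖ < R`, slice-curve families analytic on `|τ| < ϱ` into the closed `R′`-ball (`R′ < R`), `δ`-close
  there and jointly continuous — leaf-06-g7's `norm_curPieceDiff_le` carried THROUGH the identity; gain `ϱ⁻ⁿ` kept.
NOT TAKEN here: the species producer on `CurData` and the END's `hTcup` (sibling `NE9CurveSpeciesCoupling`), additivity in the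
old term ((w19), leaf-08-g4).  NOT PRINTED and not claimed: anything about Bałaban's 𝐇_k, Lemma 4, U^c_j, or that his (1.23)
pieces are these `curPiece`s (O-NE9-1).  DISGUISE TEST: one analytic term, one polymer functional, two slice-curve families —
no history, no renormalised term; not NE9.

WHAT IS PROVED (kernel, `[folklore]`; 0 sorry, 0 `def`): §1 `curRem_eq_sub_sum`, `continuousOn_curRem_comp`; §2
`curPiece_sub_curPiece`, `norm_curPiece_sub_curPiece_le`.

References (TYPES only): T. Bałaban, *Renormalization group approach to lattice gauge field theories. II. Cluster expansions*,
Commun. Math. Phys. **116** (1988) 1–22 [Balaban1988RG2Cluster], (1.21)–(1.24) p. 7; T. Bałaban, *Renormalization group approach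
to lattice gauge field theories. I*, Commun. Math. Phys. **109** (1987) 249–301 [Balaban1987RG1], (3.34)∕(3.37) p. 277, Lemma 4
(3.53)–(3.54) p. 280.  Summits-side NEW work (LEAN PLACEMENT RULE); imports leaf-06-g7's `NE9CurveRemainderCoupling` and
leaf-03-g4's `NE9RemainderPieceLinear` (hence `NE9CauchyOpLinear`, the owner's `NE9Lemma1CurveRemainder`) BY NAME; modifies
nothing; no END face re-wired.  Value = the instantiation-side identification closing the A3 engine for the curve species at
FORM level, NOT summit progress.
-/

noncomputable section

namespace Summit.QuantumFields.BalabanUV.T4Continuum.NE9CurveRemainderLinear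

open scoped BigOperators
open Metric Set Complex
open Literature.MathematicalPhysics.QuantumFieldTheory.Balaban1983to89
open Literature.MathematicalPhysics.QuantumFieldTheory.Balaban1983to89.B13Sect1Arith (cauchyOp)
open Summit.QuantumFields.BalabanUV.T4Continuum.NE9Lemma1RemainderPiece
open Summit.QuantumFields.BalabanUV.T4Continuum.NE9Lemma1CurveRemainder
open Summit.QuantumFields.BalabanUV.T4Continuum.NE9CauchyOpLinear
open Summit.QuantumFields.BalabanUV.T4Continuum.NE9RemainderPieceLinear (tail_eq_circleIntegral movesClosed_constraint)
open Summit.QuantumFields.BalabanUV.T4Continuum.NE9CurveRemainderCoupling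

/-! ## §1 The curve remainder in closed form; parametric continuity of `p ↦ curRem H n (Γ p)` on a SET -/

section Curve

variable {E : Type*} [NormedAddCommGroup E] [NormedSpace ℂ E] {F : Type*} [NormedAddCommGroup F] [NormedSpace ℂ F]
  [CompleteSpace F]

/-- The curve remainder in closed form: for `γ` analytic on `|τ| < ϱ` (`ϱ > 1`) into the analyticity ball of `H`,
`curRem H n γ = H(γ 1) − Σ_{m<n} (2πi)⁻¹∮_{|τ|=1} τ^{−(m+1)} H(γ τ) dτ` (each Newton–Taylor coefficient of the composite slice
is a Cauchy integral over the unit circle — leaf-03-g4's `tail_eq_circleIntegral`). [folklore] -/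
theorem curRem_eq_sub_sum {H : E → F} {R ϱ : ℝ} (hH : DifferentiableOn ℂ H (ball 0 R)) {γ : ℂ → E}
    (hγ : DifferentiableOn ℂ γ (ball 0 ϱ)) (hmaps : MapsTo γ (ball 0 ϱ) (ball 0 R)) (hϱ : 1 < ϱ) (n : ℕ) :
    curRem H n γ = H (γ 1) - ∑ m ∈ Finset.range n,
      (2 * Real.pi * I : ℂ)⁻¹ • ∮ τ in C(0, 1), (τ ^ (m + 1))⁻¹ • H (γ τ) := by
  have hslice := differentiableOn_curSlice hH hγ hmaps
  unfold curRem taylorRem taylorHead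
  simp only [one_pow, one_smul]
  congr 1
  exact Finset.sum_congr rfl fun m _ => tail_eq_circleIntegral one_pos hϱ m _ hslice

/-- **PARAMETRIC CONTINUITY OF THE CURVE REMAINDER ON A SET (kernel).**  `H` analytic on `‖z‖ < R`; a slice-curve FAMILY
`Γ : P → ℂ → E` which, at every parameter `p ∈ S`, is analytic on the disc `|τ| < ϱ` (`ϱ > 1`) and maps it into that ball,
and which is JOINTLY continuous in `(p, τ)` on `S ×ˢ {|τ| = 1}`.  Then `p ↦ curRem H n (Γ p)` is continuous on `S` (the head
`H(Γ p 1)` and every coefficient `(2πi)⁻¹∮_{|τ|=1} τ^{−(m+1)} H(Γ p τ) dτ` are continuous on `S`; no sup bound on `H`).  TYPE: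
[II] p. 7 continues the (1.23)-integrands analytically in the contour variables — *"we represent all derivatives by the Cauchy
formula"*; asserted here for nothing of Bałaban's. [cite: Balaban1988RG2Cluster, (1.23) p.7] -/
theorem continuousOn_curRem_comp {P : Type*} [TopologicalSpace P] {S : Set P} {H : E → F} {R ϱ : ℝ} (n : ℕ)
    (hH : DifferentiableOn ℂ H (ball 0 R)) (hϱ : 1 < ϱ) {Γ : P → ℂ → E}
    (hΓ : ∀ p ∈ S, DifferentiableOn ℂ (Γ p) (ball 0 ϱ) ∧ MapsTo (Γ p) (ball 0 ϱ) (ball 0 R))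
    (hΓc : ContinuousOn (fun q : P × ℂ => Γ q.1 q.2) (S ×ˢ sphere (0:ℂ) 1)) :
    ContinuousOn (fun p => curRem H n (Γ p)) S := by
  have hHc : ContinuousOn H (ball 0 R) := hH.continuousOn
  have hsph : ∀ τ ∈ sphere (0:ℂ) 1, τ ∈ ball (0:ℂ) ϱ := fun τ hτ => by
    have h1 : ‖τ‖ = 1 := by simpa using hτ
    rw [mem_ball_zero_iff, h1]; exact hϱ
  -- `(p, τ) ↦ H (Γ p τ)` is continuous on `S ×ˢ sphere 0 1`
  have hHΓ : ContinuousOn (fun q : P × ℂ => H (Γ q.1 q.2)) (S ×ˢ sphere (0:ℂ) 1) :=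
    hHc.comp hΓc fun q hq => (hΓ q.1 hq.1).2 (hsph q.2 hq.2)
  have hterm : ∀ m : ℕ, ContinuousOn
      (fun p : P => (2 * Real.pi * I : ℂ)⁻¹ • ∮ τ in C(0, 1), (τ ^ (m + 1))⁻¹ • H (Γ p τ)) S := by
    intro m
    refine (continuousOn_circleIntegral_of_continuousOn zero_le_one
      (G := fun (p : P) (τ : ℂ) => (τ ^ (m + 1))⁻¹ • H (Γ p τ)) ?_).const_smul _
    refine ContinuousOn.smul ?_ hHΓ
    refine ContinuousOn.inv₀ (by fun_prop) fun q hq => pow_ne_zero _ ?_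
    have h1 : ‖q.2‖ = 1 := by simpa using hq.2
    intro h0
    rw [h0, norm_zero] at h1
    exact zero_ne_one h1
  have hhead : ContinuousOn (fun p : P => H (Γ p 1)) S := by
    have h1 : (1:ℂ) ∈ sphere (0:ℂ) 1 := by simp
    exact hHΓ.comp (f := fun p : P => (p, (1:ℂ))) (Continuous.continuousOn (by fun_prop)) fun p hp => ⟨hp, h1⟩
  have hg : ContinuousOn (fun p : P => H (Γ p 1) - ∑ m ∈ Finset.range n,
      (2 * Real.pi * I : ℂ)⁻¹ • ∮ τ in C(0, 1), (τ ^ (m + 1))⁻¹ • H (Γ p τ)) S :=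
    hhead.sub (continuousOn_finsetSum _ fun m _ => hterm m)
  exact hg.congr fun p hp => curRem_eq_sub_sum hH (hΓ p hp).1 (hΓ p hp).2 hϱ n

end Curve

/-! ## §2 `curPiece Γ − curPiece Γ′` IS the (1.23)-functional of the remainder difference; the closed-form response -/

section Piece

variable {E : Type*} [NormedAddCommGroup E] [NormedSpace ℂ E] {F : Type*} [NormedAddCommGroup F] [NormedSpace ℂ F]
  [CompleteSpace F] {ι : Type*} [DecidableEq ι]

/-- **`curPiece Γ − curPiece Γ′` IS THE (1.23)-FUNCTIONAL OF THE CURVE-REMAINDER DIFFERENCE (kernel; the identity leaf-06-g7's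
p213961 left instantiation-side).**  For an old term `H` analytic on `‖z‖ < R`, `ρ > 1`, `r > 0`, `ϱ > 1`, and two slice-curve
families `Γ, Γ′` which at every contour point `(|t| = r, s(Δ) ∈ [0,1], |σ(Δ)| = ρ)` are analytic on `|τ| < ϱ` into the ball
and are JOINTLY CONTINUOUS in `(t, s, σ, τ)` on `(contours) × {|τ| = 1}`, the difference of the owner's (1.23)-functionals of the
order-`n` remainder along `Γ` and along `Γ′` equals the (1.23)-functional of the DIFFERENCE of the two remainders, at every
admissible `(s, σ)` — `NE9CauchyOpLinear.pieceOp_sub` with the integrands `(t, s, σ) ↦ curRem H n (Γ t s σ)` continuous by §1.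
[cite: Balaban1988RG2Cluster, (1.23) p.7] -/
theorem curPiece_sub_curPiece {ρ r R ϱ : ℝ} {n : ℕ} (hρ : 1 < ρ) (hr : 0 < r) {H : E → F}
    (hH : DifferentiableOn ℂ H (ball 0 R)) (hϱ : 1 < ϱ) (l : List ι) (Γ Γ' : ℂ → (ι → ℝ) → (ι → ℂ) → ℂ → E)
    (hΓ : ∀ t ∈ sphere (0:ℂ) r, ∀ s σ, (∀ i ∈ l, s i ∈ Icc (0:ℝ) 1 ∧ σ i ∈ sphere (0:ℂ) ρ) →
      DifferentiableOn ℂ (Γ t s σ) (ball 0 ϱ) ∧ MapsTo (Γ t s σ) (ball 0 ϱ) (ball 0 R))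
    (hΓ' : ∀ t ∈ sphere (0:ℂ) r, ∀ s σ, (∀ i ∈ l, s i ∈ Icc (0:ℝ) 1 ∧ σ i ∈ sphere (0:ℂ) ρ) →
      DifferentiableOn ℂ (Γ' t s σ) (ball 0 ϱ) ∧ MapsTo (Γ' t s σ) (ball 0 ϱ) (ball 0 R))
    (hΓc : ContinuousOn (fun q : (ℂ × ((ι → ℝ) × (ι → ℂ))) × ℂ => Γ q.1.1 q.1.2.1 q.1.2.2 q.2)
      ((sphere (0:ℂ) r ×ˢ {q | ∀ i ∈ l, q.1 i ∈ Icc (0:ℝ) 1 ∧ q.2 i ∈ sphere (0:ℂ) ρ}) ×ˢ sphere (0:ℂ) 1))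
    (hΓ'c : ContinuousOn (fun q : (ℂ × ((ι → ℝ) × (ι → ℂ))) × ℂ => Γ' q.1.1 q.1.2.1 q.1.2.2 q.2)
      ((sphere (0:ℂ) r ×ˢ {q | ∀ i ∈ l, q.1 i ∈ Icc (0:ℝ) 1 ∧ q.2 i ∈ sphere (0:ℂ) ρ}) ×ˢ sphere (0:ℂ) 1))
    (s : ι → ℝ) (σ : ι → ℂ) (hsσ : ∀ i ∈ l, s i ∈ Icc (0:ℝ) 1 ∧ σ i ∈ sphere (0:ℂ) ρ) :
    curPiece ρ r l H n Γ s σ - curPiece ρ r l H n Γ' s σ =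
      (2 * Real.pi * I : ℂ)⁻¹ • ∮ t in C(0, r), (t ^ 2)⁻¹ •
        cauchyOp ρ l (fun s' σ' => curRem H n (Γ t s' σ') - curRem H n (Γ' t s' σ')) s σ := by
  have hΦ : ∀ B : ℂ → (ι → ℝ) → (ι → ℂ) → ℂ → E,
      (∀ t ∈ sphere (0:ℂ) r, ∀ s σ, (∀ i ∈ l, s i ∈ Icc (0:ℝ) 1 ∧ σ i ∈ sphere (0:ℂ) ρ) →
        DifferentiableOn ℂ (B t s σ) (ball 0 ϱ) ∧ MapsTo (B t s σ) (ball 0 ϱ) (ball 0 R)) →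
      ContinuousOn (fun q : (ℂ × ((ι → ℝ) × (ι → ℂ))) × ℂ => B q.1.1 q.1.2.1 q.1.2.2 q.2)
        ((sphere (0:ℂ) r ×ˢ {q | ∀ i ∈ l, q.1 i ∈ Icc (0:ℝ) 1 ∧ q.2 i ∈ sphere (0:ℂ) ρ}) ×ˢ sphere (0:ℂ) 1) →
      ContinuousOn (fun p : ℂ × ((ι → ℝ) × (ι → ℂ)) => curRem H n (B p.1 p.2.1 p.2.2))
        (sphere (0:ℂ) r ×ˢ {q | ∀ i ∈ l, q.1 i ∈ Icc (0:ℝ) 1 ∧ q.2 i ∈ sphere (0:ℂ) ρ}) := by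
    intro B hB hBc
    exact continuousOn_curRem_comp n hH hϱ (Γ := fun p : ℂ × ((ι → ℝ) × (ι → ℂ)) => B p.1 p.2.1 p.2.2)
      (fun p hp => hB p.1 hp.1 p.2.1 p.2.2 hp.2) hBc
  have key := pieceOp_sub hρ hr (fun s σ => ∀ i ∈ l, s i ∈ Icc (0:ℝ) 1 ∧ σ i ∈ sphere (0:ℂ) ρ) l
    (movesClosed_constraint ρ l) (fun t s σ => curRem H n (Γ t s σ)) (fun t s σ => curRem H n (Γ' t s σ))
    (hΦ Γ hΓ hΓc) (hΦ Γ' hΓ' hΓ'c) s σ hsσ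
  unfold curPiece
  exact key.symm

/-- **THE CURVE SPECIES' PER-PIECE COUPLING RESPONSE IN CLOSED FORM (kernel).**  With `ρ = e^{κ₁}`, `κ₁ ≥ 1`, the t_□-radius
`r > 0`, an old term `H` analytic on `‖z‖ < R` with `‖H‖ ≤ M` there, and two slice-curve families `Γ, Γ′` (↔ the Lemma-4 curve
through the contour point at two shift amplitudes — [I] (3.53) p. 280, [II] (1.21)–(1.23) p. 7, TYPE) which at every contour point
are analytic on `|τ| < ϱ` (`ϱ > 1`) with values in the CLOSED ball of radius `R′ < R`, differ by at most `δ` there (↔ `a₁·|s − s′|`,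
TYPE (1.21)), and are jointly continuous on `(contours) × {|τ| = 1}`:
`‖curPiece ρ r l H n Γ s σ − curPiece ρ r l H n Γ′ s σ‖ ≤ (1∕r)·(2ⁿ·(2M∕(R−R′)·δ)·ϱ⁻¹ⁿ)·exp(−(κ₁−1)·#l)` — leaf-06-g7's
`norm_curPieceDiff_le` carried THROUGH the identity `curPiece_sub_curPiece`.  NOT asserted: anything about Bałaban's 𝐇_k, Lemma 4,
U^c_j, or that his (1.23) pieces are these `curPiece`s (O-NE9-1). [cite: Balaban1988RG2Cluster, (1.23)-(1.24) p.7; Balaban1987RG1,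
(3.53)-(3.54) p.280] -/
theorem norm_curPiece_sub_curPiece_le {κ₁ r R R' M ϱ δ : ℝ} {n : ℕ} (hκ : 1 ≤ κ₁) (hr : 0 < r) {H : E → F}
    (hH : DifferentiableOn ℂ H (ball 0 R)) (hM : ∀ z ∈ ball (0 : E) R, ‖H z‖ ≤ M) (hR'R : R' < R) (hϱ : 1 < ϱ)
    (hδ : 0 ≤ δ) (l : List ι) (Γ Γ' : ℂ → (ι → ℝ) → (ι → ℂ) → ℂ → E)
    (hΓ : ∀ t ∈ sphere (0 : ℂ) r, ∀ s σ, (∀ i ∈ l, s i ∈ Icc (0 : ℝ) 1 ∧ σ i ∈ sphere (0 : ℂ) (Real.exp κ₁)) →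
      DifferentiableOn ℂ (Γ t s σ) (ball 0 ϱ) ∧ ∀ σ' ∈ ball (0 : ℂ) ϱ, ‖Γ t s σ σ'‖ ≤ R')
    (hΓ' : ∀ t ∈ sphere (0 : ℂ) r, ∀ s σ, (∀ i ∈ l, s i ∈ Icc (0 : ℝ) 1 ∧ σ i ∈ sphere (0 : ℂ) (Real.exp κ₁)) →
      DifferentiableOn ℂ (Γ' t s σ) (ball 0 ϱ) ∧ ∀ σ' ∈ ball (0 : ℂ) ϱ, ‖Γ' t s σ σ'‖ ≤ R')
    (hΓc : ContinuousOn (fun q : (ℂ × ((ι → ℝ) × (ι → ℂ))) × ℂ => Γ q.1.1 q.1.2.1 q.1.2.2 q.2)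
      ((sphere (0:ℂ) r ×ˢ {q | ∀ i ∈ l, q.1 i ∈ Icc (0:ℝ) 1 ∧ q.2 i ∈ sphere (0:ℂ) (Real.exp κ₁)}) ×ˢ
        sphere (0:ℂ) 1))
    (hΓ'c : ContinuousOn (fun q : (ℂ × ((ι → ℝ) × (ι → ℂ))) × ℂ => Γ' q.1.1 q.1.2.1 q.1.2.2 q.2)
      ((sphere (0:ℂ) r ×ˢ {q | ∀ i ∈ l, q.1 i ∈ Icc (0:ℝ) 1 ∧ q.2 i ∈ sphere (0:ℂ) (Real.exp κ₁)}) ×ˢ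
        sphere (0:ℂ) 1))
    (hΓΓ' : ∀ t ∈ sphere (0 : ℂ) r, ∀ s σ,
      (∀ i ∈ l, s i ∈ Icc (0 : ℝ) 1 ∧ σ i ∈ sphere (0 : ℂ) (Real.exp κ₁)) →
        ∀ σ' ∈ ball (0 : ℂ) ϱ, ‖Γ t s σ σ' - Γ' t s σ σ'‖ ≤ δ)
    (s : ι → ℝ) (σ : ι → ℂ) (hsσ : ∀ i ∈ l, s i ∈ Icc (0 : ℝ) 1 ∧ σ i ∈ sphere (0 : ℂ) (Real.exp κ₁)) :
    ‖curPiece (Real.exp κ₁) r l H n Γ s σ - curPiece (Real.exp κ₁) r l H n Γ' s σ‖ ≤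
      (1 / r) * (2 ^ n * (2 * M / (R - R') * δ) * ϱ⁻¹ ^ n) * Real.exp (-(κ₁ - 1) * l.length) := by
  have hρ : 1 < Real.exp κ₁ := by
    have := Real.add_one_le_exp κ₁
    linarith
  rw [curPiece_sub_curPiece hρ hr hH hϱ l Γ Γ'
    (fun t ht s σ hsσ => ⟨(hΓ t ht s σ hsσ).1, mapsTo_ball_of_norm_le (hΓ t ht s σ hsσ).2 hR'R⟩)
    (fun t ht s σ hsσ => ⟨(hΓ' t ht s σ hsσ).1, mapsTo_ball_of_norm_le (hΓ' t ht s σ hsσ).2 hR'R⟩) hΓc hΓ'c s σ hsσ]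
  exact norm_curPieceDiff_le hκ hr hH hM hR'R hϱ hδ l Γ Γ' hΓ hΓ' hΓΓ' s σ hsσ

end Piece

end Summit.QuantumFields.BalabanUV.T4Continuum.NE9CurveRemainderLinear

end
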